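/-
Copyright: lit-balaban Phase-2 proof seat p08 (gen 7).  Statement-level skeleton of a published paper; no proof claims beyond what
the kernel checks below.
-/
import Literature.MathematicalPhysics.QuantumFieldTheory.BalabanImbrieJaffe1984to88.BIJ88Ineq217SigmaTorus
import Literature.MathematicalPhysics.QuantumFieldTheory.BalabanImbrieJaffe1984to88.BIJ88Close218Proof
import Literature.MathematicalPhysics.QuantumFieldTheory.BalabanImbrieJaffe1984to88.BIJ85Thm711Torus

/-!
# `BalabanImbrieJaffe1984to88.BIJ88Ineq219SigmaTorus` — T. Bałaban, J. Imbrie, A. Jaffe, *Effective action and cluster properties of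
the abelian Higgs model*, Commun. Math. Phys. **114** (1988) 257–315 [BalabanImbrieJaffe1988]: **(2.18)–(2.19)** p. 262 FOR THE TORUS
σ_k OF RECORD — the input *"It was also shown in [2] that σ_k is bounded from below"* is now a THEOREM with a k-UNIFORM constant
([2] = [I] Theorem 7.1.1 on the tori: p33's `BIJ85Thm711Torus.ineq423_uniform`, `2·c711(d)·w·‖f‖² ≤ ⟨f, σ_kf⟩`), so r18's typed (2.19)
`BIJ88Sect2Statements.Ineq219` HOLDS for the kernel of p30's `sigmaTorus` (`ineq219_sigmaKernel`), and p02's knitting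
`BIJ88Close218Proof.close218`/`ineq219_of_close` ((2.16) ⟹ (2.18) ⟹ (2.19)) yields **(2.19) for σ_{k,loc} = the (2.14)-truncation of the
torus kernel** with ONLY (2.16) displayed (`ineq219_sigmaLoc_torus`)

statement-level skeleton of published theorems with citation tags; proofs where landed; nothing here is a claim about the Yang–Mills mass gap

PDF held: `paper:balaban1988-cmp114-bij-abelian-higgs-effective-action` (journal page = PDF page + 256), pp. 261–262 [PDF 5–6] (text layer
re-read this session); [2] = [I] = [BalabanImbrieJaffe1985] (`paper:balaban1985-cmp97-bij-higgs-minimizers`), Thm. 7.1.1 p. 321, (4.2.3)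
p. 310.

CITATION HEADER (lean-in-tree rule).  Part of the lit-balaban TYPED SKELETON (HOME `run/shared/lean/pub/lit-balaban/`), Phase-2 proof
seat p08 (gen 7), unit `lit-balaban-p08`; WHAT IS REPRODUCED = SKELETON rows **C2.Eq2.19** and **C2.Eq2.18** (reader file
`HOME/lit-balaban-r18/ROWS-C2.md`, owner r18, referee ref-5: *"proved p248140 (p02 g3; printed implication σ_k ≥ c₀ ∧ (2.18) ⇒ (2.19))"*,
*"proved p248140 (p02 g3; hence-step (2.16)+(2.14) ⇒ (2.18))"* — knitting over abstract kernels), kind «model instance» for the torus σ_k;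
consumer of row **C1.Thm7.1.1** (p33 g5 `BIJ85Thm711Torus`, p256165).  TAKING line HOME/STATUS.md (gen 7, fifth target).

THE PRINTED TEXT (p. 262 [PDF 6], verbatim): *"It was also shown in [2] that σ_k is bounded from below. In view of (2.16) we have that
|σ_{k,loc}(p₁,p₂) − σ_k(p₁,p₂)| ≦ ce^{−cr(e_k)}e^{−c dist(p₁,p₂)}, (2.18) so that (2.16), (2.17) hold for σ_{k,loc}, and σ_{k,loc} ≧ c > 0
(2.19) as well."*; (2.14) p. 261: *"σ_{k,loc}(p₁,p₂) = σ_k(p₁,p₂) if dist(p₁,p₂) ≦ (1/2L)r(e_{k−1}), 0 otherwise"*.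

THE TORUS DATA (all in the tree; standing range `k ≤ m + K`, weight `w > 0` (print: `w = η^d`), curl factor `c ≠ 0`, `2 ≤ d`, odd `L`):
the kernel of p30's `σ_k = sigmaTorus hd w c k` on the unit plaquettes `TPlaq P k`, `σ(p, q) := (σ_ke_q)(p)` (`e_q = toU(δ_q)`; gen 7's
`BIJ88Ineq217SigmaTorus.applyK_sigmaKernel`); σ_{k,loc} = r18's sharp truncation `trunc pdist R σ` ((2.14), `R = (1/2L)r(e_{k−1})`); the
plaquette distance `pdist` (gen 6) and its row sums `BIJ88Ineq217Torus.sum_plaq_exp_neg_pdist_le`; the Theorem 7.1.1 constant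
`BIJ85SigmaClosedCube.c711 d` (p10/p27/p33).

WHAT IS PROVED (0 `sorry`, standard axioms; theorems only — proof lane):
* §1 `inner_eq_sum_applyK` (the quadratic form of the kernel IS `⟨f, σ_kf⟩`), **`ineq219_sigmaKernel`** — r18's `Ineq219 σ (2·c711(d)·w)`
  for the kernel of the torus σ_k: *"σ_k is bounded from below"* with the k-uniform constant of [I] Thm. 7.1.1 (p33's `ineq423_uniform`).
* §2 `pdist_comm`; **`close218_sigmaKernel`** — (2.18) for the truncated torus kernel from (2.16) (p02's `close_trunc_of_decayFar`).
* §3 **`ineq219_sigmaLoc_torus`** — (2.19) ON THE TORUS: `Ineq219 (trunc pdist R σ) (2·c711(d)·w − c₁e^{−(c₁/2)R}·S)`, `S = d²(2(1 + 2/c₁))^d`,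
  for every truncation radius `R ≥ c₁` with `c₁e^{−(c₁/2)R}·S < 2·c711(d)·w` (the «r(e_{k−1}) large» condition, displayed), given ONLY
  (2.16) `DecayFar pdist σ c₁` (`0 < c₁`) for the torus kernel; `ineq219_sigmaLoc_printedRadius` at `R = r(e_{k−1})/(2L)`.
HONEST SCOPE.  (2.16) for the kernel of the torus σ_k (row C2.Eq2.16; the propagator decay of [2]/[B5]) is THE displayed hypothesis;
the largeness of `r(e_{k−1})` enters as the explicit inequality `hsmall`; constants explicit, not print's generic `c`; one torus at a
time but the lower-bound constant `2·c711(d)·w` is uniform in `k` and in the volume (p33); no `def`, no new named fact; NOT summit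
progress.  Unit `lit-balaban-p08` (literature-prover-lit-balaban-p08-g7-0), 2026-08-21.
-/

open scoped BigOperators RealInnerProductSpace

namespace Literature.MathematicalPhysics.QuantumFieldTheory.BalabanImbrieJaffe1984to88.BIJ88Ineq219SigmaTorus

open Balaban1983to89 hiding Site Plaq
open Balaban1983to89.LatticeFieldCalculus Balaban1983to89.T4AxialGaugeSmallField
open BIJ88Sect2Statements BIJ88Close218Proof BIJ88Ineq217Mechanism BIJ88Ineq217NearPart BIJ88Ineq217Torus BIJ88Ineq217SigmaTorus
open BIJ85AxialPropagator411 BIJ85Sigma421Torus BIJ85Thm711Torus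
open BIJ85SigmaClosedCube (c711 c711_pos)
-- inside this namespace the bare `Site`/`Plaq` are the `ℤ^d` carriers of the QFT root; the torus ones are renamed:
open Balaban1983to89 renaming Site → TSite, Plaq → TPlaq

noncomputable section

variable {P : Params}

/-! ## §1  *"σ_k is bounded from below"* for the kernel of the torus σ_k, k-uniformly -/

/-- Components are unchanged by p30's `toU`. [folklore] -/
private theorem toU_apply' (k : ℕ) (g : TPlaq P k → ℝ) (p : TPlaq P k) : toU P k g p = g p := rfl

/-- **The quadratic form of the kernel is the form of σ_k**: `Σ_p f(p)·(applyK σ f)(p) = ⟨toU f, σ_k(toU f)⟩` for the kernel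
`σ(p, q) = (σ_ke_q)(p)` (`applyK_sigmaKernel`). [cite: BalabanImbrieJaffe1988, (2.19) p.262] -/
theorem inner_eq_sum_applyK (hd : 2 ≤ P.d) (w c : ℝ) (k : ℕ) (f : TPlaq P k → ℝ) :
    ∑ p, f p * applyK (fun p q => sigmaTorus (P := P) hd w c k (toU P k (Pi.single q 1)) p) f p =
      ⟪toU P k f, sigmaTorus (P := P) hd w c k (toU P k f)⟫ := by
  simp only [applyK_sigmaKernel]
  rw [PiLp.inner_apply]
  refine Finset.sum_congr rfl fun p _ => ?_
  rw [RCLike.inner_apply, RCLike.conj_to_real, toU_apply', mul_comm]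

/-- `Σ_p f(p)² = ‖toU f‖²`. [cite: BalabanImbrieJaffe1988, (2.19) p.262] -/
theorem sum_sq_eq_norm_toU_sq (k : ℕ) (f : TPlaq P k → ℝ) : ∑ p, f p ^ 2 = ‖toU P k f‖ ^ 2 := by
  rw [EuclideanSpace.real_norm_sq_eq]
  exact Finset.sum_congr rfl fun p _ => by rw [toU_apply']

/-- **«σ_k is bounded from below [2]» FOR THE KERNEL OF THE TORUS σ_k, k-UNIFORMLY** — r18's typed (2.19)-shape `Ineq219 σ (2·c711(d)·w)`:
`0 < 2c711(d)w` and `2c711(d)w·Σ_p f(p)² ≤ Σ_p f(p)(σf)(p)` for every `f`, where `σ(p, q) = (σ_ke_q)(p)` is the kernel of p30's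
`sigmaTorus hd w c k` — [I] Theorem 7.1.1 on the tori (p33's `BIJ85Thm711Torus.ineq423_uniform`, constant uniform in `k` and in the volume);
`k ≤ m + K`, `w > 0`, `c ≠ 0`, `2 ≤ d`. [cite: BalabanImbrieJaffe1988, (2.19) p.262] -/
theorem ineq219_sigmaKernel (hd : 2 ≤ P.d) {k : ℕ} (hk : k ≤ P.m + P.K) {w : ℝ} (hw : 0 < w) {c : ℝ} (hc : c ≠ 0) :
    Ineq219 (fun p q => sigmaTorus (P := P) hd w c k (toU P k (Pi.single q 1)) p) (2 * c711 P.d * w) := by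
  refine ⟨by have := c711_pos (show 0 < P.d by omega); positivity, fun f => ?_⟩
  rw [inner_eq_sum_applyK, sum_sq_eq_norm_toU_sq]
  exact ineq423_uniform hd hk hw hc (toU P k f)

/-! ## §2  (2.18) for the truncated torus kernel from (2.16) -/

/-- the plaquette distance is symmetric. [cite: BalabanImbrieJaffe1988, (2.14) p.261] -/
theorem pdist_comm {j : ℕ} (p q : TPlaq P j) : pdist p q = pdist q p := by
  unfold pdist
  rw [tdist_comm]

/-- **(2.18) ON THE TORUS from (2.16)** p. 262: for the kernel `σ` of the torus σ_k with (2.16) `DecayFar pdist σ c₁` (`0 ≤ c₁`) and the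
(2.14) truncation `σ_{k,loc} = trunc pdist R σ` at any radius `R ≥ c₁`: `|σ_{k,loc}(p₁,p₂) − σ(p₁,p₂)| ≤ c₁e^{−(c₁/2)R}·e^{−(c₁/2)pdist(p₁,p₂)}`
(p02's `close_trunc_of_decayFar`; print's `ce^{−cr(e_k)}e^{−c dist}` at `R = (1/2L)r(e_{k−1})`). [cite: BalabanImbrieJaffe1988, (2.18) p.262] -/
theorem close218_sigmaKernel (hd : 2 ≤ P.d) (w c : ℝ) (k : ℕ) {c₁ R : ℝ} (hc₁ : 0 ≤ c₁) (hR : c₁ ≤ R)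
    (h216 : DecayFar pdist (fun p q => sigmaTorus (P := P) hd w c k (toU P k (Pi.single q 1)) p) c₁) :
    Close pdist (trunc pdist R fun p q => sigmaTorus (P := P) hd w c k (toU P k (Pi.single q 1)) p)
      (fun p q => sigmaTorus (P := P) hd w c k (toU P k (Pi.single q 1)) p) (c₁ * Real.exp (-(c₁ / 2) * R)) (c₁ / 2) :=
  close_trunc_of_decayFar hc₁ hR h216

/-! ## §3  (2.19) on the torus: σ_{k,loc} ≥ c > 0 -/

/-- **(2.19) ON THE TORUS FOR σ_{k,loc} = THE (2.14)-TRUNCATION OF THE KERNEL OF THE σ_k OF RECORD** p. 262, verbatim: *"It was also shown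
in [2] that σ_k is bounded from below. In view of (2.16) we have (2.18) so that … σ_{k,loc} ≧ c > 0 (2.19) as well"* — r18's
`Ineq219 σ_{k,loc} (2·c711(d)·w − c₁e^{−(c₁/2)R}·S)`, `S = d²(2(1 + (c₁/2)⁻¹))^d` (row sums of `e^{−(c₁/2)pdist}`), for every truncation
radius `R ≥ c₁` at which `c₁e^{−(c₁/2)R}·S < 2·c711(d)·w` (`hsmall` — the «r(e_{k−1}) large» condition of print), GIVEN ONLY (2.16) for the
torus kernel (`h216`, `0 < c₁`): the lower bound is [I] Thm. 7.1.1 on the tori (`ineq219_sigmaKernel`, p33), the closeness is (2.18)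
(`close218_sigmaKernel`), the knitting is p02's `ineq219_of_close`; `k ≤ m + K`, `w > 0`, `c ≠ 0`, `2 ≤ d`.
[cite: BalabanImbrieJaffe1988, (2.19) p.262] -/
theorem ineq219_sigmaLoc_torus (hd : 2 ≤ P.d) {k : ℕ} (hk : k ≤ P.m + P.K) {w : ℝ} (hw : 0 < w) {c : ℝ} (hc : c ≠ 0)
    {c₁ R : ℝ} (hc₁ : 0 < c₁) (hR : c₁ ≤ R)
    (h216 : DecayFar pdist (fun p q => sigmaTorus (P := P) hd w c k (toU P k (Pi.single q 1)) p) c₁)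
    (hsmall : c₁ * Real.exp (-(c₁ / 2) * R) * ((P.d : ℝ) * P.d * (2 * (1 + (c₁ / 2)⁻¹)) ^ P.d) < 2 * c711 P.d * w) :
    Ineq219 (trunc pdist R fun p q => sigmaTorus (P := P) hd w c k (toU P k (Pi.single q 1)) p)
      (2 * c711 P.d * w - c₁ * Real.exp (-(c₁ / 2) * R) * ((P.d : ℝ) * P.d * (2 * (1 + (c₁ / 2)⁻¹)) ^ P.d)) :=
  ineq219_of_close (ineq219_sigmaKernel hd hk hw hc) (close218_sigmaKernel hd w c k hc₁.le hR h216) pdist_comm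
    (fun p₁ => sum_plaq_exp_neg_pdist_le (half_pos hc₁) p₁) (by positivity) hsmall

/-- **(2.19) at the printed radius** `R = r(e_{k−1})/(2L)` of (2.14) (`rekm1` = r(e_{k−1})): the same statement, the truncation being p02's
`close218` shape. [cite: BalabanImbrieJaffe1988, (2.19) p.262] -/
theorem ineq219_sigmaLoc_printedRadius (hd : 2 ≤ P.d) {k : ℕ} (hk : k ≤ P.m + P.K) {w : ℝ} (hw : 0 < w) {c : ℝ} (hc : c ≠ 0)
    {c₁ L rekm1 : ℝ} (hc₁ : 0 < c₁) (hR : c₁ ≤ rekm1 / (2 * L))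
    (h216 : DecayFar pdist (fun p q => sigmaTorus (P := P) hd w c k (toU P k (Pi.single q 1)) p) c₁)
    (hsmall : c₁ * Real.exp (-(c₁ / 2) * (rekm1 / (2 * L))) * ((P.d : ℝ) * P.d * (2 * (1 + (c₁ / 2)⁻¹)) ^ P.d) <
      2 * c711 P.d * w) :
    Ineq219 (trunc pdist (rekm1 / (2 * L)) fun p q => sigmaTorus (P := P) hd w c k (toU P k (Pi.single q 1)) p)
      (2 * c711 P.d * w - c₁ * Real.exp (-(c₁ / 2) * (rekm1 / (2 * L))) * ((P.d : ℝ) * P.d * (2 * (1 + (c₁ / 2)⁻¹)) ^ P.d)) :=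
  ineq219_sigmaLoc_torus hd hk hw hc hc₁ hR h216 hsmall

/-- **The largeness condition is met for `R` large**: since `c₁e^{−(c₁/2)R}S → 0`, there is `R₀ ≥ c₁` beyond which `hsmall` holds — the
quantitative content of *"r(e_k) … large"*. [cite: BalabanImbrieJaffe1988, (2.19) p.262] -/
theorem exists_radius_small {d : ℕ} (hd : 0 < d) {c₁ w : ℝ} (hc₁ : 0 < c₁) (hw : 0 < w) :
    ∃ R₀ : ℝ, c₁ ≤ R₀ ∧ ∀ R, R₀ ≤ R →
      c₁ * Real.exp (-(c₁ / 2) * R) * ((d : ℝ) * d * (2 * (1 + (c₁ / 2)⁻¹)) ^ d) < 2 * c711 d * w := by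
  set S : ℝ := (d : ℝ) * d * (2 * (1 + (c₁ / 2)⁻¹)) ^ d with hS
  have hS0 : 0 < S := by positivity
  have htarget : 0 < 2 * c711 d * w := by have := c711_pos hd; positivity
  have hcS : c₁ * S ≠ 0 := (mul_pos hc₁ hS0).ne'
  have hq : 0 < 2 * c711 d * w / (c₁ * S) := div_pos htarget (mul_pos hc₁ hS0)
  set R₁ : ℝ := -(2 / c₁) * Real.log (2 * c711 d * w / (c₁ * S)) with hR₁
  refine ⟨max c₁ (R₁ + 1), le_max_left _ _, fun R hR => ?_⟩
  have hRgt : R₁ < R := by linarith [le_max_right c₁ (R₁ + 1)]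
  have hexp : Real.exp (-(c₁ / 2) * R) < 2 * c711 d * w / (c₁ * S) := by
    rw [← Real.exp_log hq]
    apply Real.exp_lt_exp.2
    have h2 : c₁ / 2 * (2 / c₁) = 1 := by field_simp
    have h1 : -(c₁ / 2) * R₁ = Real.log (2 * c711 d * w / (c₁ * S)) := by
      rw [hR₁, show -(c₁ / 2) * (-(2 / c₁) * Real.log (2 * c711 d * w / (c₁ * S))) =
        (c₁ / 2 * (2 / c₁)) * Real.log (2 * c711 d * w / (c₁ * S)) by ring, h2, one_mul]
    rw [← h1]
    exact mul_lt_mul_of_neg_left hRgt (by linarith)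
  calc c₁ * Real.exp (-(c₁ / 2) * R) * S = (c₁ * S) * Real.exp (-(c₁ / 2) * R) := by ring
    _ < (c₁ * S) * (2 * c711 d * w / (c₁ * S)) := mul_lt_mul_of_pos_left hexp (mul_pos hc₁ hS0)
    _ = 2 * c711 d * w := by field_simp

end

end Literature.MathematicalPhysics.QuantumFieldTheory.BalabanImbrieJaffe1984to88.BIJ88Ineq219SigmaTorus
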